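import Summits.ABC.IUTFork.Cor312IdentifiedContentful
import HarnessLib

/-!
# [IUTchIII] Cor. 3.12 — the `p`-adic SPHERE MODEL, I: spheres, honest Haar volumes on balls ∪ spheres, and the typed Theorem 3.11

Record file (D-0012; toy MODEL DATA + proof; NO `Prop` fact) of the abc-iut cell (wave-4 prover abc-iut-w4-d021, gen 3; by-name
support for the IUT REPAIR BRANCH — abc-iut-rp-m3's open cell of row RP-M32b «ball models cannot separate volume from region»,
STATUS 2026-08-26T06:31:06Z, and abc-iut-rp-bar's BAR-V `VolumePinned`). Part I of two: the carrier-level data; Part II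
(`Cor312PinnedSphereSeparation`) builds the pinned setting and proves the separation «volume identity ⇏ region identification».
TAKES NO SIDE on [IUTchIII] Cor. 3.12 or on any author; instantiated ≠ endorsed; typed ≠ proved.

THE MODEL. abc-iut-w5-d247's sign shells / `toyIndex` / columns (sign-twisted Kummer transport) / link (`Cor312NaiveThm311`), with the
Thm. 3.11 (i)(a) data ENLARGED HONESTLY: admissible regions = the balls `B_k` AND the spheres `S_k := {x | v_p(line x) = k}`
(`= B_k ∖ B_{k+1}`), Haar log-volumes `logvol(B_k) = −k·log p`, `logvol(S_k) = −k·log p + log(1 − 1/p)` (normalised by `μ(B_0) = 0`).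
* `pSphere`, `pt_mem_pSphere`, `pSphere_ne_pBall`, `image_pSphere_of_mem_closure` (every element of ⟨(Ind1) ∪ (Ind2)⟩ acts by signs and
  FIXES every sphere), `pFrame_hull_pSphere` (`hull(S_k) = B_k` in the frame of balls);
* `sphereVol`, `sphereVol_pBall`, `sphereVol_pSphere`, `sphereVol_pSphere_two` (at `p = 2`: `μ(S_k) = μ(B_{k+1})` — a sphere and the next
  ball have EQUAL volume), `sphereVol_mono` (monotone on balls ∪ spheres);
* `sphereData` / `sphereColumn` / `sphereSituation` / `sphereFull` and **`sphereFull_statement`**: the typed Theorem 3.11 (i) ∧ (ii) ∧ (iii)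
  HOLDS (KummerA: signs transport balls to balls and spheres to spheres with the same volume); `sphereFull_kummerB`.
HONEST SCOPE: a ONE-PLACE, `l⋇ = 2`, `ℚ`-linear toy exactly as contentful as `naiveFull`; it models nothing of the intended arithmetic data.
[claim: Mochizuki2012, status: disputed] [cite: ScholzeStix2018, §2.2 pp. 9–10]
-/

noncomputable section

open Set

namespace Summit.ABC.IUTFork.Cor312Vol.NaiveWitness

open Thm311 Cor312 Cor312Vol Cor312.Checks Cor312.IdentifiedNonVacuity Literature.IUT.LogThetaLattice

variable (p : ℕ) [hp : Fact p.Prime]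

/-! ## 1. `p`-adic spheres on the packet lines -/

/-- The `p`-ADIC SPHERE `S_k := {x | v_p(line x) = k}` (`= B_k ∖ B_{k+1}`) of a tensor packet of the sign shells. [folklore] -/
def pSphere (j : toyIndex.Label) (vQ : toyIndex.VQ) (k : ℤ) : Set (signShells.Packet j vQ) :=
  {x | line j vQ x ≠ 0 ∧ padicValRat p (line j vQ x) = k}

omit hp in
/-- `S_k ⊆ B_k`. [folklore] -/
theorem pSphere_subset_pBall (j : toyIndex.Label) (vQ : toyIndex.VQ) (k : ℤ) : pSphere p j vQ k ⊆ pBall p j vQ k :=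
  fun _ hx => Or.inr hx.2.ge

/-- `p^k ∈ S_k`. [folklore] -/
theorem pt_mem_pSphere (j : toyIndex.Label) (vQ : toyIndex.VQ) (k : ℤ) : pt p j vQ k ∈ pSphere p j vQ k :=
  ⟨by rw [line_pt]; exact ppow_ne_zero p k, by rw [line_pt, padicValRat_ppow]⟩

omit hp in
/-- `0 ∉ S_k`. [folklore] -/
theorem zero_notMem_pSphere (j : toyIndex.Label) (vQ : toyIndex.VQ) (k : ℤ) :
    (0 : signShells.Packet j vQ) ∉ pSphere p j vQ k := fun h => h.1 (map_zero _)

omit hp in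
/-- A sphere is not a ball (`0` tells them apart). [folklore] -/
theorem pSphere_ne_pBall (j : toyIndex.Label) (vQ : toyIndex.VQ) (k k' : ℤ) : pSphere p j vQ k ≠ pBall p j vQ k' := fun h =>
  zero_notMem_pSphere p j vQ k (h ▸ zero_mem_pBall p j vQ k')

/-- `S_k ⊆ B_{k'} ↔ k' ≤ k`. [folklore] -/
theorem pSphere_subset_pBall_iff (j : toyIndex.Label) (vQ : toyIndex.VQ) (k k' : ℤ) :
    pSphere p j vQ k ⊆ pBall p j vQ k' ↔ k' ≤ k :=
  ⟨fun h => (pt_mem_pBall_iff p j vQ k k').1 (h (pt_mem_pSphere p j vQ k)),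
    fun h => (pSphere_subset_pBall p j vQ k).trans (pBall_mono p j vQ h)⟩

omit hp in
/-- No ball lies in a sphere. [folklore] -/
theorem not_pBall_subset_pSphere (j : toyIndex.Label) (vQ : toyIndex.VQ) (k k' : ℤ) :
    ¬ pBall p j vQ k' ⊆ pSphere p j vQ k := fun h => zero_notMem_pSphere p j vQ k (h (zero_mem_pBall p j vQ k'))

/-- `S_k ⊆ S_{k'} ↔ k = k'`. [folklore] -/
theorem pSphere_subset_pSphere_iff (j : toyIndex.Label) (vQ : toyIndex.VQ) (k k' : ℤ) :
    pSphere p j vQ k ⊆ pSphere p j vQ k' ↔ k = k' :=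
  ⟨fun h => by have := (h (pt_mem_pSphere p j vQ k)).2; rwa [line_pt, padicValRat_ppow] at this,
    fun h => h ▸ subset_rfl⟩

/-- `k ↦ S_k` is injective. [folklore] -/
theorem pSphere_injective (j : toyIndex.Label) (vQ : toyIndex.VQ) : Function.Injective (pSphere p j vQ) :=
  fun k k' h => (pSphere_subset_pSphere_iff p j vQ k k').1 h.le

omit hp in
/-- **A family acting by signs FIXES every sphere** (signs change neither vanishing nor `v_p`). [folklore] -/
theorem image_pSphere_of_actsBySigns {Φ : signShells.PacketAut} (h : ActsBySigns Φ) (j : toyIndex.Label)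
    (vQ : toyIndex.VQ) (k : ℤ) : Φ j vQ '' pSphere p j vQ k = pSphere p j vQ k := by
  obtain ⟨ε, hε, hΦ⟩ := h.sign j vQ
  have key : ∀ x : signShells.Packet j vQ, Φ j vQ x ∈ pSphere p j vQ k ↔ x ∈ pSphere p j vQ k := by
    intro x
    show (line j vQ (Φ j vQ x) ≠ 0 ∧ _) ↔ (line j vQ x ≠ 0 ∧ _)
    rw [hΦ]
    rcases (abs_eq (zero_le_one' ℚ)).1 hε with rfl | rfl
    · rw [one_mul]
    · rw [neg_one_mul, neg_ne_zero, padicValRat.neg]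
  apply Set.Subset.antisymm
  · rintro _ ⟨x, hx, rfl⟩; exact (key x).2 hx
  · intro x hx
    exact ⟨(Φ j vQ).symm x, (key _).1 (by rw [LinearEquiv.apply_symm_apply]; exact hx), LinearEquiv.apply_symm_apply _ _⟩

omit hp in
/-- Every element of ⟨(Ind1) ∪ (Ind2)⟩ fixes every sphere. [folklore] -/
theorem image_pSphere_of_mem_closure {Φ : signShells.PacketAut}
    (h : Φ ∈ Subgroup.closure (signShells.Ind1Family ∪ signShells.Ind2Family)) (j : toyIndex.Label) (vQ : toyIndex.VQ) (k : ℤ) :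
    Φ j vQ '' pSphere p j vQ k = pSphere p j vQ k :=
  image_pSphere_of_actsBySigns p (actsBySigns_of_mem_closure h) j vQ k

/-- The hull frame of balls takes `S_k` to `B_k`: a sphere is bounded, admits its hull (it contains `p^k` of exact valuation `k`), and
the smallest ball containing it is `B_k`. [folklore] -/
theorem pFrame_bounded_hasHull_pSphere (j : toyIndex.Label) (vQ : toyIndex.VQ) (k : ℤ) :
    (pFrame p j vQ).IsBounded (pSphere p j vQ k) ∧ (pFrame p j vQ).HasHull (pSphere p j vQ k) :=
  ⟨⟨k, pSphere_subset_pBall p j vQ k⟩, ⟨k, pSphere_subset_pBall p j vQ k, pt p j vQ k, pt_mem_pSphere p j vQ k,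
    by rw [line_pt]; exact ppow_ne_zero p k, by rw [line_pt, padicValRat_ppow]⟩⟩

/-- `hull(S_k) = B_k`. [folklore] -/
theorem pFrame_hull_pSphere (j : toyIndex.Label) (vQ : toyIndex.VQ) (k : ℤ) :
    (pFrame p j vQ).hull (pSphere p j vQ k) = pBall p j vQ k := by
  refine Set.Subset.antisymm ((pFrame p j vQ).hull_subset_of_mem ⟨k, rfl⟩ (pSphere_subset_pBall p j vQ k)) ?_
  obtain ⟨k', hk'⟩ := (pFrame p j vQ).hull_mem_of_hasHull (pFrame_bounded_hasHull_pSphere p j vQ k).1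
    (pFrame_bounded_hasHull_pSphere p j vQ k).2
  have hsub : pSphere p j vQ k ⊆ pBall p j vQ k' := by rw [hk']; exact (pFrame p j vQ).subset_hull _
  rw [← hk']
  exact pBall_mono p j vQ ((pSphere_subset_pBall_iff p j vQ k k').1 hsub)

/-! ## 2. Honest Haar log-volume on balls AND spheres -/

open scoped Classical in
/-- The HAAR LOG-VOLUME of the sphere model: `μ(B_k) = −k·log p`, `μ(S_k) = −k·log p + log(1 − 1/p)` (`μ(B_k ∖ B_{k+1}) =
(1 − 1/p)·μ(B_k)`), `0` elsewhere (never evaluated). [folklore] -/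
def sphereVol (j : toyIndex.Label) (vQ : toyIndex.VQ) (A : Set (signShells.Packet j vQ)) : ℝ :=
  if h : ∃ k, A = pBall p j vQ k then -(h.choose : ℝ) * Real.log p
  else if h' : ∃ k, A = pSphere p j vQ k then -(h'.choose : ℝ) * Real.log p + Real.log (1 - 1 / (p : ℝ))
  else 0

/-- `μ(B_k) = −k·log p`. [folklore] -/
theorem sphereVol_pBall (j : toyIndex.Label) (vQ : toyIndex.VQ) (k : ℤ) :
    sphereVol p j vQ (pBall p j vQ k) = -(k : ℝ) * Real.log p := by
  classical
  have h : ∃ k', pBall p j vQ k = pBall p j vQ k' := ⟨k, rfl⟩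
  unfold sphereVol
  rw [dif_pos h, pBall_injective p j vQ h.choose_spec.symm]

/-- `μ(S_k) = −k·log p + log(1 − 1/p)`. [folklore] -/
theorem sphereVol_pSphere (j : toyIndex.Label) (vQ : toyIndex.VQ) (k : ℤ) :
    sphereVol p j vQ (pSphere p j vQ k) = -(k : ℝ) * Real.log p + Real.log (1 - 1 / (p : ℝ)) := by
  classical
  have h : ¬ ∃ k', pSphere p j vQ k = pBall p j vQ k' := fun ⟨k', hk'⟩ => pSphere_ne_pBall p j vQ k k' hk'
  have h' : ∃ k', pSphere p j vQ k = pSphere p j vQ k' := ⟨k, rfl⟩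
  unfold sphereVol
  rw [dif_neg h, dif_pos h', pSphere_injective p j vQ h'.choose_spec.symm]

/-- At `p = 2`: `μ(S_k) = −(k+1)·log 2 = μ(B_{k+1})` — a sphere and the next ball have EQUAL volume. [folklore] -/
theorem sphereVol_pSphere_two (j : toyIndex.Label) (vQ : toyIndex.VQ) (k : ℤ) :
    sphereVol 2 j vQ (pSphere 2 j vQ k) = sphereVol 2 j vQ (pBall 2 j vQ (k + 1)) := by
  haveI : Fact (Nat.Prime 2) := ⟨Nat.prime_two⟩
  rw [sphereVol_pSphere, sphereVol_pBall]
  have h : Real.log (1 - 1 / ((2 : ℕ) : ℝ)) = -Real.log 2 := by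
    rw [show (1 - 1 / ((2 : ℕ) : ℝ)) = (2 : ℝ)⁻¹ by norm_num, Real.log_inv]
  rw [h]; push_cast; ring

/-- The log-volume is MONOTONE on balls ∪ spheres (honest Haar measure). [folklore] -/
theorem sphereVol_mono {j : toyIndex.Label} {vQ : toyIndex.VQ} {A B : Set (signShells.Packet j vQ)}
    (hA : (∃ k, A = pBall p j vQ k) ∨ (∃ k, A = pSphere p j vQ k)) (hB : (∃ k, B = pBall p j vQ k) ∨ (∃ k, B = pSphere p j vQ k))
    (hAB : A ⊆ B) : sphereVol p j vQ A ≤ sphereVol p j vQ B := by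
  have hlogp := log_p_pos p
  have hlog1 : Real.log (1 - 1 / (p : ℝ)) ≤ 0 := by
    apply Real.log_nonpos
    · have : (1 : ℝ) ≤ p := by exact_mod_cast hp.out.one_lt.le
      have : 0 < (p : ℝ) := by positivity
      rw [sub_nonneg, div_le_one this]; exact ‹(1:ℝ) ≤ p›
    · rw [sub_le_self_iff]; positivity
  rcases hA with ⟨k, rfl⟩ | ⟨k, rfl⟩ <;> rcases hB with ⟨k', rfl⟩ | ⟨k', rfl⟩
  · rw [sphereVol_pBall, sphereVol_pBall]
    have hk : (k' : ℝ) ≤ k := by exact_mod_cast (pBall_subset_iff p j vQ k k').1 hAB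
    nlinarith
  · exact absurd hAB (not_pBall_subset_pSphere p j vQ k' k)
  · rw [sphereVol_pSphere, sphereVol_pBall]
    have hk : (k' : ℝ) ≤ k := by exact_mod_cast (pSphere_subset_pBall_iff p j vQ k k').1 hAB
    nlinarith
  · rw [(pSphere_subset_pSphere_iff p j vQ k k').1 hAB]

/-! ## 3. The sphere-enlarged Thm. 3.11 (i) data, situation and full situation; the typed Theorem 3.11 holds -/

/-- **The data (a)(b)(c) of the sphere model**: as `naiveData`, but with admissible regions the balls AND the spheres, and the honest
Haar log-volume on both. [claim: Mochizuki2012, status: disputed] -/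
def sphereData : MRData signShells where
  shellPk := fun j vQ => pBall p j vQ 0
  shellSub := fun j v => pBall p j (toyIndex.over v) 0
  Adm := fun j vQ A => (∃ k, A = pBall p j vQ k) ∨ (∃ k, A = pSphere p j vQ k)
  logvol := fun j vQ A => sphereVol p j vQ A
  Ψ := fun v _ => Psi p v
  act := fun v _ y => LinearMap.pi fun j => (line j.1 (toyIndex.over v) (y j)) • LinearMap.proj j
  Mmod := fun _ => Set.univ

/-- The sphere SITUATION (an `abbrev`: `.L` reduces to `signShells`). [claim: Mochizuki2012, status: disputed] -/
abbrev sphereSituation : Situation toyIndex where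
  L := signShells
  D := fun _ => sphereData p
  G := fun _ j => naiveDegrees p j

/-- **The column of the sphere model**: abc-iut-w5-d247's `naiveColumn` (sign-twisted Kummer transport, tagged Frobenioid objects,
Θ-pilot of index `1`) with the Frobenius-like admissibility / log-volume the twisted transports of the SPHERE data.
[claim: Mochizuki2012, status: disputed] -/
def sphereColumn : Column signShells :=
  { naiveColumn p with
    frobAdm := fun m j vQ A => (sphereData p).Adm j vQ (twist m j vQ '' A)
    frobLogvol := fun m j vQ A => sphereVol p j vQ (twist m j vQ '' A) }

/-- The sphere FULL SITUATION: the sphere columns and abc-iut-w5-d247's link, over the sphere data.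
[claim: Mochizuki2012, status: disputed] -/
abbrev sphereFull : FullSituation toyIndex where
  toSituation := sphereSituation p
  col := fun _ => sphereColumn p
  link := naiveLink

/-- (i) for the sphere model (degrees of `p^k𝒪` = volumes of the balls `B_k`, which are admissible). [folklore] -/
theorem sphere_partI : (sphereFull p).PartI := by
  refine ⟨fun n v hv x _ j => ?_, fun n j k => ⟨fun vQ => Or.inl ⟨k, rfl⟩, Set.toFinite _, ?_⟩, fun _ _ => rfl⟩
  · show x j ∈ signShells.SubPacket j.1 v
    rw [subPacket_eq_top]; trivial
  · rw [finsum_unique]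
    exact (sphereVol_pBall p j.1 _ k).symm

omit hp in
/-- (ii) for the sphere model: KummerA = signs transport balls to balls and spheres to spheres with the same volume; KummerB/C and
(Ind3) as in the naive model. [folklore] -/
theorem sphere_partII : (sphereFull p).toLatticeSituation.PartII := by
  intro n
  refine (Column.partII_iff _ _).2 ⟨?_, fun m v hv => image_Psi_of_actsBySigns p (twist_actsBySigns m) v,
    fun m j => Set.image_univ_of_surjective (signShells.globalAut (twist m) j.1).surjective, ?_⟩
  · rintro m j vQ A (⟨k, rfl⟩ | ⟨k, rfl⟩)
    · show (sphereData p).Adm j vQ (twist m j vQ '' pBall p j vQ k) ∧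
        sphereVol p j vQ (twist m j vQ '' pBall p j vQ k) = sphereVol p j vQ (pBall p j vQ k)
      rw [image_pBall_twist]
      exact ⟨Or.inl ⟨k, rfl⟩, rfl⟩
    · show (sphereData p).Adm j vQ (twist m j vQ '' pSphere p j vQ k) ∧
        sphereVol p j vQ (twist m j vQ '' pSphere p j vQ k) = sphereVol p j vQ (pSphere p j vQ k)
      rw [image_pSphere_of_actsBySigns p (twist_actsBySigns m)]
      exact ⟨Or.inr ⟨k, rfl⟩, rfl⟩
  · refine ⟨fun m m' j vQ _ => pBall_mono p j vQ (by omega), fun m j vQ h => absurd trivial h⟩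

/-- (iii) for the sphere model (link and columns are the naive ones). [folklore] -/
theorem sphere_partIII : (sphereFull p).PartIII := by
  refine ⟨naiveLink.partIIIa_holds, naiveLink.partIIIb_holds, ?_, ?_,
    (sphereFull p).evalCompatUpToInd_of_multiradialCompat (sphere_partI p).2.2⟩
  · refine naiveLink.partIIIc_of_full (fun _ => rfl) fun n m => ?_
    rintro _ ⟨a, rfl⟩
    show unitIso a ≪≫ unitIso ((-1) ^ m.natAbs) = unitIso ((-1) ^ m.natAbs) ≪≫ unitIso a
    rw [unitIso_trans, unitIso_trans, mul_comm]
  · intro n m; exact Thm311.PolyIsoCalc.stabilized_full _ _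

/-- **The typed Theorem 3.11 (i) ∧ (ii) ∧ (iii) HOLDS in the sphere model.** [folklore] -/
theorem sphereFull_statement : (sphereFull p).Statement := ⟨sphere_partI p, sphere_partII p, sphere_partIII p⟩

omit hp in
/-- Thm. 3.11 (ii)(b) for every column of the sphere model: `frobΨ m = Ψ`. [folklore] -/
theorem sphereFull_kummerB (n : ℤ) : ((sphereFull p).toLatticeSituation.col n).KummerB ((sphereFull p).toLatticeSituation.D n) :=
  (sphere_partII p n).2.1

end Summit.ABC.IUTFork.Cor312Vol.NaiveWitness

end
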